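import Summits.Ventures.PercRepro2.CaseOneStarCertT1
import Summits.Ventures.PercRepro2.CaseOneGadgetUWA1BBlockII0
import Summits.Ventures.PercRepro2.CaseOneGadgetUWA1BBlockII1
import Summits.Ventures.PercRepro2.CaseOneGadgetUWA1BBlockII2
import Summits.Ventures.PercRepro2.CaseOneGadgetUWA1BBlockII3
import Summits.Ventures.PercRepro2.CaseOneGadgetUWA1BBlockII4
import Summits.Ventures.PercRepro2.CaseOneGadgetUWA1BBlockII5
import Summits.Ventures.PercRepro2.CaseOneGadgetUWA1BBlockII6
import Summits.Ventures.PercRepro2.CaseOneGadgetUWA1BBlockII7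
import Summits.Ventures.PercRepro2.CaseOneGadgetUWA1BBlockII8
import Summits.Ventures.PercRepro2.CaseOneGadgetUWA1BBlockII9
import Summits.Ventures.PercRepro2.CaseOneGadgetUWA1BBlockII10
import Summits.Ventures.PercRepro2.CaseOneGadgetUWA1BBlockII11
import Summits.Ventures.PercRepro2.CaseOneGadgetUWA1BBlockII12
import Summits.Ventures.PercRepro2.CaseOneGadgetUWA1BBlockII13
import Summits.Ventures.PercRepro2.CaseOneGadgetUWA1BBlockII14
import Summits.Ventures.PercRepro2.CaseOneStarFactsB

/-!
# The gadget `u ~ {w, a₁, b}`, `w ~ {u, a₂, o}` (uwa1b): the cell certificates of `iiAB5` (part 40b)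
(blind cell PercRepro2, p1 g34; the fourth gadget anchor of the six-form calculus — all six forms of the uwa1b gadget
as plain SFacts-cone certificate chains, generated by mining/p1/g34/uwa1b/genu.py = p1 g33's gent_uwa1.py / g25's
geno.py re-targeted; P1-G33 §6–§6″, P1-G34)

Each `eBABII ijk kl` is a nonnegative combination of `(pairwise atom) × (cell)` and cubic cell monomials — or, for the degree-4 ones, `M × eBABII ijk kl` (`M = Σ cᵢ` the total cell mass) is a nonnegative combination of `(atom) × (cell) × (cell)` and quartic cell monomials, then `SFacts.nonneg_of_sum_mul` (`CaseOneStarCertT1`) — exact LP certificates (kit j318477, every certificate re-verified exactly; data/p1/g33/gcerts_ii_uwa1b.json, form `ii`), here as exact `linear_combination`s over `SFacts` (the rational coefficients cleared by their common denominator). -/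

namespace Summit.Ventures.PercRepro2

namespace CaseOne

section CertABII40b
variable {R : Type*} [Field R] [LinearOrder R] [IsStrictOrderedRing R]

set_option maxHeartbeats 0 in
/-- `eBABII32222 ≥ 0`: the combination is identically zero (`ring`). -/
lemma eBABII32222_nonneg (m : SCells R) (_hf : SFactsB m) : 0 ≤ eBABII32222 m := by
  have h : eBABII32222 m = 0 := by
    unfold eBABII32222 cBABII00122 cBABII00222 cBABII01022 cBABII01122 cBABII01222 cBABII02022 cBABII02122 cBABII02222 cBABII10022 cBABII10122 cBABII10222 cBABII11022 cBABII11122 cBABII11222 cBABII12022 cBABII12122 cBABII12222 cBABII20022 cBABII20122 cBABII20222 cBABII21022 cBABII21122 cBABII21222 cBABII22022 cBABII22122 cBABII22222 cBABII30122 cBABII30222 cBABII31022 cBABII31122 cBABII31222 cBABII32022 cBABII32122 cBABII32222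
    ring
  linarith [h]

set_option maxHeartbeats 0 in
/-- `eBABII32223 ≥ 0`: the combination is identically zero (`ring`). -/
lemma eBABII32223_nonneg (m : SCells R) (_hf : SFactsB m) : 0 ≤ eBABII32223 m := by
  have h : eBABII32223 m = 0 := by
    unfold eBABII32223 cBABII00123 cBABII00223 cBABII01023 cBABII01123 cBABII01223 cBABII02023 cBABII02123 cBABII02223 cBABII10023 cBABII10123 cBABII10223 cBABII11023 cBABII11123 cBABII11223 cBABII12023 cBABII12123 cBABII12223 cBABII20023 cBABII20123 cBABII20223 cBABII21023 cBABII21123 cBABII21223 cBABII22023 cBABII22123 cBABII22223 cBABII30123 cBABII30223 cBABII31023 cBABII31123 cBABII31223 cBABII32023 cBABII32123 cBABII32223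
    ring
  linarith [h]

end CertABII40b

end CaseOne

end Summit.Ventures.PercRepro2
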